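import Literature.NumberTheory.Transcendental.RoyCriterionProofs
import Mathlib.Analysis.Calculus.Deriv.Polynomial
import Mathlib.Analysis.Complex.AbsMax
import Mathlib.Analysis.SpecialFunctions.Complex.Log
import Mathlib.LinearAlgebra.Lagrange
import Mathlib.Analysis.SpecialFunctions.Trigonometric.Bounds
import Mathlib.Analysis.SpecialFunctions.Complex.Arg
import Mathlib.Algebra.Order.Round
import Mathlib.Algebra.Polynomial.BigOperators
import HarnessLib

/-!
# Roy's criterion — Proposition 3 and the discharge of `Roy2001_iff` (Roy 2001, §§4–5)

Topic: `Literature/NumberTheory/Transcendental`. Companion of `RoyCriterion.lean` and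
`RoyCriterionProofs.lean`; it completes the discharge of the named fact
`Literature.NumberTheory.Transcendental.Roy2001_iff` (`provefact-Literature.Transcend.Roy2001_iff`):

* `Roy2001_prop3_holds : Roy2001_prop3` — **Proposition 3** of Roy 2001 (p. 192): if
  `α e^{-y}` is not a root of unity and `max{1, t₀, 2t₁} < min{s₀, 2s₁} < u`, then condition (b)
  of Theorem 1 fails for `(y, α)`.
* `royThm1BtoA_holds : RoyThm1BtoA` — the implication `(b) ⇒ (a)` of **Theorem 1** (p. 184).
* `Roy2001_iff_holds : Roy2001_iff` — **the equivalence of Roy's Conjecture 2 with Schanuel's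
  conjecture, rank by rank** (Roy 2001, §5, pp. 193–194), from `Roy2001_iff_of_prop3`
  (`RoyCriterionProofs.lean`, which proves §5 with the auxiliary polynomial `exists_royAuxPoly`
  in place of Theorem 3) and `Roy2001_prop3_holds`.

## The proof of Proposition 3 given here

Roy (pp. 192–193) derives Proposition 3 from his two-variable interpolation estimate
(Theorem 2, vendored as the named fact `Roy2001_thm2`) applied to `F(z, w) = Q(z, e^w)` on the
lattice `ℤ(y, λ) + ℤ(0, 2πi)`, plus Lemma 4 (`Roy2001_lemma4`, proved). Mathlib has no Cauchy
formula on polydiscs, so instead of Theorem 2 we use the following one-variable route, which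
proves Proposition 3 *exactly as printed* (same hypotheses `max{1, t₀, 2t₁} < min{s₀, 2s₁} < u`;
in fact only `max{1, t₀, 2t₁} < s₀` and `t₁ ≤ s₁`, `2t₁ < u` are used):

1. (`prop3_taylor`) Along the direction `w = (1, 1)`: `g_n(t) = Q(ny + t, α^n e^t)` satisfies
   `g_n^{(k)}(0) = (D^k Q)(ny, α^n)` (`iteratedDeriv_aeval_add_mul_exp`; this is Roy's remark
   `d^k g_N/dz^k = (D^k Q_N)(z, ζ^m e^z)`, p. 191), so condition (b) makes the first `M^{s₀}`
   Taylor coefficients of `g_n` tiny, and the Cauchy estimates on `|t| = 2ρ` control the tail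
   (`norm_le_of_norm_iteratedDeriv_le`): `|g_n| ≤ ε₁` on `|t| ≤ ρ = 1 + M^{t₁}|y|`, `n ≤ M^{t₁}`.
2. (`prop3_smallness`) For `|z| ≤ 1` the polynomial `h_z(X) = Q(z, e^z X)` of degree
   `D₁ ≤ M^{t₁}` satisfies `h_z(β^n) = g_n(z - ny)` with `β = α e^{-y}`; Lagrange interpolation
   at the `D₁ + 1` nodes `β^n` (`norm_eval_le_of_nodes`, from `Lagrange.eq_interpolate`) bounds
   `h_z` on `|X| ≤ e`, at the cost of a factor `(D₁+1) ((e + B^{D₁}) / (b^{D₁} δ))^{D₁}` where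
   `δ ≤ |β^j - 1|` (`1 ≤ j ≤ D₁`) separates the nodes; then `1 ≤ H(Q) ≤ sup_{|ζ|=1} |Q(ζ^{D₁+1}, ζ)|`
   (`one_le_of_forall_norm_aeval_le`, Cauchy's inequality for the coefficients — Roy's
   "`1 ≤ H(Q) ≤ |Q|₁ ≤ |F|_π`", p. 193) and `Q(ζ^{D₁+1}, ζ) = h_{ζ^{D₁+1}}(ζ e^{-ζ^{D₁+1}})`.
3. (`prop3_numeric`, `eventually_prop3_numerics`) the resulting quantity is `< 1` for large `M`
   because `max{1, t₀, 2t₁} < s₀` and `2t₁ < u` — the same exponent bookkeeping as on p. 193.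
4. The separation `δ`: if `|β| ≠ 1`, `δ = ||β| - 1|` (no Diophantine input); if `|β| = 1`,
   `β = e^{2πia}` with `a` irrational (this is `¬(a)`), and Roy's Lemma 4 at level `N` gives
   `|β^j - 1| ≥ 2/N` for `1 ≤ j < N` (`two_div_le_norm_pow_sub_one`); one takes
   `M = ⌈N^{1/(t₁+1)}⌉`, so that `δ = 1/N ≥ M^{-(t₁+1)}` — as in print, Lemma 4 is the only
   arithmetic ingredient.

## Sources

* D. Roy, *An arithmetic criterion for the values of the exponential function*, Acta Arith. 97
  (2001), 183–194: Prop. 3 (p. 192–193), Lemma 4 (p. 192), §5 (pp. 193–194). [Roy2001]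

## Design choices

* No new definitions: the slices `t ↦ Q(z + t, β e^t)` and `X ↦ Q(z, c X)` are written out
  (`fun t => aeval ![z + t, β * cexp t] Q`, `∑ m ∈ Q.support, monomial (m 1) (Q_m z^{m 0} c^{m 1})`).
* The analytic part is split into `prop3_taylor` / `prop3_smallness` / `prop3_numeric` with all
  quantities as free real parameters, assembled in `prop3_core`; `Roy2001_prop3_holds` adds the
  choice of `δ` and `M` (item 4 above).
-/

noncomputable section

open MvPolynomial Filter Complex Metric Asymptotics

namespace Literature.NumberTheory.Transcendental

/-! ### Derivatives of `t ↦ Q(z + t, β e^t)` -/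

/-- `d/dt Q(z + t, β e^t) = (DQ)(z + t, β e^t)` for Roy's derivation `D = ∂₀ + X₁ ∂₁`
(Roy 2001, p. 191: `d^k g_N / dz^k (z) = (D^k Q_N)(z, ζ^m e^z)`). [cite: Roy2001, §4 (p. 191)] -/
theorem hasDerivAt_aeval_add_mul_exp (Q : MvPolynomial (Fin 2) ℤ) (z β t : ℂ) :
    HasDerivAt (fun s => aeval ![z + s, β * cexp s] Q) (aeval ![z + t, β * cexp t] (royD Q)) t := by
  induction Q using MvPolynomial.induction_on with
  | C a =>
    have h1 : (fun s => aeval ![z + s, β * cexp s] (C a : MvPolynomial (Fin 2) ℤ)) =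
        fun _ => (a : ℂ) := by
      ext w; simp
    have h2 : aeval ![z + t, β * cexp t] (royD (C a)) = 0 := by simp only [royD_C, map_zero]
    rw [h1, h2]
    exact hasDerivAt_const _ _
  | add p q hp hq =>
    have h1 : (fun s => aeval ![z + s, β * cexp s] (p + q)) =
        fun s => aeval ![z + s, β * cexp s] p + aeval ![z + s, β * cexp s] q := by
      ext w; simp
    have h2 : aeval ![z + t, β * cexp t] (royD (p + q)) =
        aeval ![z + t, β * cexp t] (royD p) + aeval ![z + t, β * cexp t] (royD q) := by
      simp
    rw [h1, h2]
    exact hp.add hq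
  | mul_X p i hp =>
    have key : ∀ j : Fin 2, j = 0 ∨ j = 1 := by decide
    rcases key i with rfl | rfl
    · have h1 : (fun s => aeval ![z + s, β * cexp s] (p * X 0)) =
          fun s => aeval ![z + s, β * cexp s] p * (z + s) := by
        ext w; simp
      have h2 : aeval ![z + t, β * cexp t] (royD (p * X 0)) =
          aeval ![z + t, β * cexp t] (royD p) * (z + t) + aeval ![z + t, β * cexp t] p * 1 := by
        simp [royD_mul, map_add, map_mul]
      rw [h1, h2]
      exact hp.mul ((hasDerivAt_id t).const_add z)
    · have h1 : (fun s => aeval ![z + s, β * cexp s] (p * X 1)) =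
          fun s => aeval ![z + s, β * cexp s] p * (β * cexp s) := by
        ext w; simp
      have h2 : aeval ![z + t, β * cexp t] (royD (p * X 1)) =
          aeval ![z + t, β * cexp t] (royD p) * (β * cexp t) +
            aeval ![z + t, β * cexp t] p * (β * cexp t) := by
        simp [royD_mul, map_add, map_mul]
      rw [h1, h2]
      exact hp.mul ((Complex.hasDerivAt_exp t).const_mul β)

/-- `d^k/dt^k Q(z + t, β e^t) = (D^k Q)(z + t, β e^t)`. [cite: Roy2001, §4 (p. 191)] -/
theorem iteratedDeriv_aeval_add_mul_exp (k : ℕ) (Q : MvPolynomial (Fin 2) ℤ) (z β : ℂ) :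
    iteratedDeriv k (fun s => aeval ![z + s, β * cexp s] Q) =
      fun s => aeval ![z + s, β * cexp s] (royD^[k] Q) := by
  induction k generalizing Q with
  | zero => simp
  | succ k ih =>
    have hd : deriv (fun s => aeval ![z + s, β * cexp s] Q) =
        fun s => aeval ![z + s, β * cexp s] (royD Q) := by
      ext t; exact (hasDerivAt_aeval_add_mul_exp Q z β t).deriv
    rw [iteratedDeriv_succ', hd, ih, Function.iterate_succ_apply]

/-! ### Growth and coefficients of `Q(z, ω)` -/

/-- The exponent vectors of `Q ∈ ℤ[X₀, X₁]` inject into `[0, deg₀ Q] × [0, deg₁ Q]`, so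
`#supp Q ≤ (deg₀ Q + 1)(deg₁ Q + 1)`. [folklore] -/
theorem card_support_le (Q : MvPolynomial (Fin 2) ℤ) :
    Q.support.card ≤ (Q.degreeOf 0 + 1) * (Q.degreeOf 1 + 1) := by
  classical
  have hmap : Set.MapsTo (fun m : Fin 2 →₀ ℕ => (m 0, m 1)) Q.support
      (Finset.range (Q.degreeOf 0 + 1) ×ˢ Finset.range (Q.degreeOf 1 + 1) : Finset (ℕ × ℕ)) := by
    intro m hm
    simp only [Finset.coe_product, Finset.coe_range, Set.mem_prod, Set.mem_Iio]
    exact ⟨Nat.lt_succ_of_le (degreeOf_le_iff.1 le_rfl m hm),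
      Nat.lt_succ_of_le (degreeOf_le_iff.1 le_rfl m hm)⟩
  have hinj : Set.InjOn (fun m : Fin 2 →₀ ℕ => (m 0, m 1)) Q.support := by
    intro m _ m' _ h
    simp only [Prod.mk.injEq] at h
    ext i
    have key : ∀ j : Fin 2, j = 0 ∨ j = 1 := by decide
    rcases key i with rfl | rfl
    · exact h.1
    · exact h.2
  calc Q.support.card ≤ (Finset.range (Q.degreeOf 0 + 1) ×ˢ Finset.range (Q.degreeOf 1 + 1)).card :=
        Finset.card_le_card_of_injOn _ hmap hinj
    _ = (Q.degreeOf 0 + 1) * (Q.degreeOf 1 + 1) := by simp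

/-- Evaluation of a monomial of `ℤ[X₀, X₁]` at `(z, ω)`. [folklore] -/
theorem aeval_monomial_two (m : Fin 2 →₀ ℕ) (c : ℤ) (z ω : ℂ) :
    aeval ![z, ω] (monomial m c) = (c : ℂ) * (z ^ (m 0) * ω ^ (m 1)) := by
  rw [aeval_monomial, Finsupp.prod_fintype _ _ (by simp)]
  simp [Fin.prod_univ_two]

/-- Growth of `Q(z, ω)`: `|Q(z, ω)| ≤ (deg₀+1)(deg₁+1) H(Q) R_z^{deg₀} R_ω^{deg₁}` for `|z| ≤ R_z`,
`|ω| ≤ R_ω`, `R_z, R_ω ≥ 1` (Roy 2001, p. 193: "`|F|_R ≤ (M^{t₀}+1)(M^{t₁}+1) exp(M + M^{t₀} log R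
+ R M^{t₁})`"). [cite: Roy2001, Prop. 3 (proof)] -/
theorem norm_aeval_le_of_degreeOf_le (Q : MvPolynomial (Fin 2) ℤ) {D₀ D₁ : ℕ}
    (h0 : Q.degreeOf 0 ≤ D₀) (h1 : Q.degreeOf 1 ≤ D₁) (z ω : ℂ) {Rz Rω : ℝ} (hz : ‖z‖ ≤ Rz)
    (hω : ‖ω‖ ≤ Rω) (hRz : 1 ≤ Rz) (hRω : 1 ≤ Rω) :
    ‖aeval ![z, ω] Q‖ ≤ ((D₀ + 1) * (D₁ + 1) : ℕ) * mvPolyHeight Q * Rz ^ D₀ * Rω ^ D₁ := by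
  have hterm : ∀ m ∈ Q.support,
      ‖aeval ![z, ω] (monomial m (coeff m Q))‖ ≤ mvPolyHeight Q * Rz ^ D₀ * Rω ^ D₁ := by
    intro m hm
    rw [aeval_monomial_two, norm_mul, norm_mul, norm_pow, norm_pow, Complex.norm_intCast]
    have hc : |((coeff m Q : ℤ) : ℝ)| ≤ mvPolyHeight Q := by
      rw [← Int.cast_abs]
      have := natAbs_coeff_le_mvPolyHeight Q m
      have h' : ((coeff m Q).natAbs : ℤ) = |coeff m Q| := Int.natCast_natAbs _
      exact_mod_cast h' ▸ (show ((coeff m Q).natAbs : ℤ) ≤ mvPolyHeight Q by exact_mod_cast this)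
    have hm0 : m 0 ≤ D₀ := (degreeOf_le_iff.1 h0) m hm
    have hm1 : m 1 ≤ D₁ := (degreeOf_le_iff.1 h1) m hm
    have hz' : ‖z‖ ^ (m 0) ≤ Rz ^ D₀ :=
      (pow_le_pow_left₀ (norm_nonneg _) hz _).trans (pow_le_pow_right₀ hRz hm0)
    have hω' : ‖ω‖ ^ (m 1) ≤ Rω ^ D₁ :=
      (pow_le_pow_left₀ (norm_nonneg _) hω _).trans (pow_le_pow_right₀ hRω hm1)
    have hH : (0 : ℝ) ≤ mvPolyHeight Q := Nat.cast_nonneg _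
    calc |((coeff m Q : ℤ) : ℝ)| * (‖z‖ ^ (m 0) * ‖ω‖ ^ (m 1))
        ≤ mvPolyHeight Q * (Rz ^ D₀ * Rω ^ D₁) := by gcongr
      _ = mvPolyHeight Q * Rz ^ D₀ * Rω ^ D₁ := by ring
  calc ‖aeval ![z, ω] Q‖ = ‖∑ m ∈ Q.support, aeval ![z, ω] (monomial m (coeff m Q))‖ := by
        rw [← map_sum, ← Q.as_sum]
    _ ≤ ∑ m ∈ Q.support, ‖aeval ![z, ω] (monomial m (coeff m Q))‖ := norm_sum_le _ _
    _ ≤ ∑ _m ∈ Q.support, mvPolyHeight Q * Rz ^ D₀ * Rω ^ D₁ := Finset.sum_le_sum hterm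
    _ = Q.support.card * (mvPolyHeight Q * Rz ^ D₀ * Rω ^ D₁) := by
        rw [Finset.sum_const, nsmul_eq_mul]
    _ ≤ ((D₀ + 1) * (D₁ + 1) : ℕ) * (mvPolyHeight Q * Rz ^ D₀ * Rω ^ D₁) := by
        gcongr
        exact (card_support_le Q).trans (Nat.mul_le_mul (Nat.succ_le_succ h0) (Nat.succ_le_succ h1))
    _ = ((D₀ + 1) * (D₁ + 1) : ℕ) * mvPolyHeight Q * Rz ^ D₀ * Rω ^ D₁ := by ring

/-- Cauchy's inequality for the coefficients of a complex polynomial on the unit circle: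
`|coeff n p| ≤ sup_{|ζ| = 1} |p(ζ)|`. [folklore] -/
theorem norm_coeff_le_of_forall_norm_eval_le (p : Polynomial ℂ) (n : ℕ) {B : ℝ}
    (hB : ∀ ζ : ℂ, ‖ζ‖ = 1 → ‖p.eval ζ‖ ≤ B) : ‖p.coeff n‖ ≤ B := by
  have hC : ∀ ζ ∈ sphere (0 : ℂ) 1, ‖(fun x => p.eval x) ζ‖ ≤ B := fun ζ hζ => hB ζ (by simpa using hζ)
  have h := Complex.norm_iteratedDeriv_le_of_forall_mem_sphere_norm_le (f := fun x => p.eval x) n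
    one_pos (p.differentiable.diffContOnCl) hC
  -- iterated derivatives of a polynomial function
  have hiter : ∀ (k : ℕ) (q : Polynomial ℂ),
      iteratedDeriv k (fun x => q.eval x) = fun x => (Polynomial.derivative^[k] q).eval x := by
    intro k
    induction k with
    | zero => intro q; simp
    | succ k ih =>
      intro q
      rw [iteratedDeriv_succ']
      have hd : deriv (fun x => q.eval x) = fun x => (Polynomial.derivative q).eval x := by
        ext x; exact q.deriv
      rw [hd, ih, Function.iterate_succ_apply]
  rw [hiter] at h
  simp only [one_pow, div_one] at h
  rw [← Polynomial.coeff_zero_eq_eval_zero, Polynomial.coeff_iterate_derivative, zero_add,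
    Nat.descFactorial_self, nsmul_eq_mul, norm_mul, Complex.norm_natCast] at h
  have hn : (0 : ℝ) < n.factorial := by positivity
  exact le_of_mul_le_mul_left h hn

/-- Lower bound (Roy 2001, p. 193: "`1 ≤ H(Q) ≤ |Q|₁ ≤ |F|_π`"), in the form: for `Q ≠ 0` and
`K > deg₁ Q`, the values `Q(ζ^K, ζ)`, `|ζ| = 1`, are not all `< 1` — since `ζ ↦ Q(ζ^K, ζ)` is a
one-variable polynomial with the same (integer) coefficients as `Q`. [cite: Roy2001, Prop. 3 (proof)] -/
theorem one_le_of_forall_norm_aeval_le (Q : MvPolynomial (Fin 2) ℤ) (hQ : Q ≠ 0) {K : ℕ}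
    (hK : Q.degreeOf 1 < K) {B : ℝ} (hB : ∀ ζ : ℂ, ‖ζ‖ = 1 → ‖aeval ![ζ ^ K, ζ] Q‖ ≤ B) :
    1 ≤ B := by
  classical
  -- the one-variable polynomial
  set p : Polynomial ℂ :=
    ∑ m ∈ Q.support, Polynomial.monomial (m 0 * K + m 1) ((coeff m Q : ℤ) : ℂ) with hp
  have heval : ∀ ζ : ℂ, p.eval ζ = aeval ![ζ ^ K, ζ] Q := by
    intro ζ
    conv_rhs => rw [Q.as_sum, map_sum]
    rw [hp, Polynomial.eval_finsetSum]
    refine Finset.sum_congr rfl fun m _ => ?_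
    rw [Polynomial.eval_monomial, aeval_monomial_two, pow_add, pow_mul']
  -- exponents are distinct on the support
  have hlt : ∀ m ∈ Q.support, m 1 < K := fun m hm =>
    lt_of_le_of_lt ((degreeOf_le_iff.1 le_rfl) m hm) hK
  have hinj : ∀ m ∈ Q.support, ∀ m' ∈ Q.support, m 0 * K + m 1 = m' 0 * K + m' 1 → m = m' := by
    intro m hm m' hm' h
    have h1 := hlt m hm
    have h2 := hlt m' hm'
    have hd : m 0 = m' 0 := by
      have := Nat.add_mul_div_left (m 1) (m 0) (Nat.zero_lt_of_lt h1)
      have := Nat.add_mul_div_left (m' 1) (m' 0) (Nat.zero_lt_of_lt h1)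
      have e1 : (m 1 + K * (m 0)) / K = m 0 := by
        rw [Nat.add_mul_div_left _ _ (Nat.zero_lt_of_lt h1), Nat.div_eq_of_lt h1, zero_add]
      have e2 : (m' 1 + K * (m' 0)) / K = m' 0 := by
        rw [Nat.add_mul_div_left _ _ (Nat.zero_lt_of_lt h1), Nat.div_eq_of_lt h2, zero_add]
      have h' : m 1 + K * m 0 = m' 1 + K * m' 0 := by linarith
      rw [← e1, ← e2, h']
    have hr : m 1 = m' 1 := by rw [hd] at h; omega
    ext i
    have key : ∀ j : Fin 2, j = 0 ∨ j = 1 := by decide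
    rcases key i with rfl | rfl
    · exact hd
    · exact hr
  -- a coefficient of absolute value ≥ 1
  obtain ⟨m₀, hm₀⟩ : Q.support.Nonempty := support_nonempty.2 hQ
  have hcoeff : p.coeff (m₀ 0 * K + m₀ 1) = ((coeff m₀ Q : ℤ) : ℂ) := by
    rw [hp, Polynomial.finsetSum_coeff, Finset.sum_eq_single m₀]
    · simp
    · intro m hm hne
      rw [Polynomial.coeff_monomial, if_neg]
      exact fun h => hne (hinj m hm m₀ hm₀ h)
    · exact fun h => absurd hm₀ h
  have hne : coeff m₀ Q ≠ 0 := mem_support_iff.1 hm₀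
  have h1 : (1 : ℝ) ≤ ‖p.coeff (m₀ 0 * K + m₀ 1)‖ := by
    rw [hcoeff, Complex.norm_intCast]
    exact_mod_cast Int.one_le_abs hne
  exact h1.trans (norm_coeff_le_of_forall_norm_eval_le p _ fun ζ hζ => (heval ζ) ▸ hB ζ hζ)

/-- Taylor expansion with small (rather than vanishing) low-order derivatives: if `f` is entire,
`|f^{(n)}(0)| ≤ A` for `n < L` and `|f| ≤ C` on `|w| = 2ρ`, then `|f(z)| ≤ A e^ρ + 2·2^{-L} C` for
`|z| ≤ ρ` (Cauchy estimates for the tail; cf. `norm_le_of_iteratedDeriv_eq_zero`). [folklore] -/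
theorem norm_le_of_norm_iteratedDeriv_le {f : ℂ → ℂ} (hf : Differentiable ℂ f) {L : ℕ}
    {ρ C A : ℝ} (hρ : 0 < ρ) (hA : 0 ≤ A) (h0 : ∀ n < L, ‖iteratedDeriv n f 0‖ ≤ A)
    (hC : ∀ w ∈ sphere (0 : ℂ) (2 * ρ), ‖f w‖ ≤ C) {z : ℂ} (hz : ‖z‖ ≤ ρ) :
    ‖f z‖ ≤ A * Real.exp ρ + 2 * (1 / 2) ^ L * C := by
  have hR : 0 < 2 * ρ := by positivity
  have hsum := Complex.hasSum_taylorSeries_of_entire hf 0 z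
  simp only [sub_zero] at hsum
  have hC0 : 0 ≤ C := by
    have hw : ((2 * ρ : ℝ) : ℂ) ∈ sphere (0 : ℂ) (2 * ρ) := by simp [hρ.le]
    exact (norm_nonneg _).trans (hC _ hw)
  -- the majorant: `A ρ^n / n!` for `n < L`, `C 2^{-n}` for `n ≥ L`
  set g₁ : ℕ → ℝ := fun n => if n < L then A * (ρ ^ n / n.factorial) else 0 with hg₁
  set g₂ : ℕ → ℝ := fun n => if n < L then 0 else C * (1 / 2) ^ n with hg₂
  have hg₁_sum : HasSum g₁ (∑ n ∈ Finset.range L, A * (ρ ^ n / n.factorial)) := by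
    have : ∑ n ∈ Finset.range L, A * (ρ ^ n / n.factorial) = ∑ n ∈ Finset.range L, g₁ n :=
      Finset.sum_congr rfl fun n hn => by simp [hg₁, Finset.mem_range.1 hn]
    rw [this]
    exact hasSum_sum_of_ne_finset_zero fun n hn => by
      simp only [Finset.mem_range, not_lt] at hn
      simp [hg₁, not_lt.2 hn]
  have hg₂_sum : HasSum g₂ (2 * (1 / 2) ^ L * C) := by
    have h1 : HasSum (fun n => g₂ (n + L)) (2 * (1 / 2) ^ L * C) := by
      have : (fun n => g₂ (n + L)) = fun n => C * (1 / 2) ^ L * ((1 : ℝ) / 2) ^ n := by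
        ext n; simp [hg₂, pow_add]; ring
      rw [this, show (2 * (1 / 2) ^ L * C : ℝ) = C * (1 / 2) ^ L * 2 by ring]
      exact hasSum_geometric_two.mul_left (C * (1 / 2) ^ L)
    have h2 : ∑ i ∈ Finset.range L, g₂ i = 0 :=
      Finset.sum_eq_zero fun i hi => by simp [hg₂, Finset.mem_range.1 hi]
    have := (hasSum_nat_add_iff L).1 h1
    rwa [h2, add_zero] at this
  have hle : ∑ n ∈ Finset.range L, A * (ρ ^ n / n.factorial) ≤ A * Real.exp ρ := by
    rw [← Finset.mul_sum]
    exact mul_le_mul_of_nonneg_left (Real.sum_le_exp_of_nonneg hρ.le L) hA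
  refine (hsum.norm_le_of_bounded (hg₁_sum.add hg₂_sum) fun n => ?_).trans (by linarith)
  by_cases hn : n < L
  · simp only [hg₁, hg₂, hn, if_true, add_zero]
    calc ‖(n.factorial : ℂ)⁻¹ • z ^ n • iteratedDeriv n f 0‖
        = (n.factorial : ℝ)⁻¹ * (‖z‖ ^ n * ‖iteratedDeriv n f 0‖) := by
          rw [norm_smul, norm_smul, norm_inv, Complex.norm_natCast, norm_pow]
      _ ≤ (n.factorial : ℝ)⁻¹ * (ρ ^ n * A) := by gcongr; exact h0 n hn
      _ = A * (ρ ^ n / n.factorial) := by ring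
  · have hcauchy := Complex.norm_iteratedDeriv_le_of_forall_mem_sphere_norm_le (f := f) n hR
      hf.diffContOnCl hC
    have hzR : ‖z‖ / (2 * ρ) ≤ 1 / 2 := by
      rw [div_le_iff₀ hR]; linarith
    simp only [hg₁, hg₂, hn, if_false, zero_add]
    calc ‖(n.factorial : ℂ)⁻¹ • z ^ n • iteratedDeriv n f 0‖
        = (n.factorial : ℝ)⁻¹ * (‖z‖ ^ n * ‖iteratedDeriv n f 0‖) := by
          rw [norm_smul, norm_smul, norm_inv, Complex.norm_natCast, norm_pow]
      _ ≤ (n.factorial : ℝ)⁻¹ * (‖z‖ ^ n * (n.factorial * C / (2 * ρ) ^ n)) := by gcongr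
      _ = C * (‖z‖ / (2 * ρ)) ^ n := by
          have : (n.factorial : ℝ) ≠ 0 := by positivity
          rw [div_pow]
          field_simp
      _ ≤ C * (1 / 2) ^ n := by gcongr

/-- Lagrange interpolation bound: a polynomial of degree `≤ D` which is `≤ ε` at `D + 1` nodes of
size `≤ V`, pairwise `≥ σ` apart, is `≤ (D+1) ((ξ+V)/σ)^D ε` on `|x| ≤ ξ` (Lagrange's
interpolation formula, `Lagrange.eq_interpolate`). [folklore] -/
theorem norm_eval_le_of_nodes {D : ℕ} (f : Polynomial ℂ) (hf : f.natDegree ≤ D) (v : ℕ → ℂ)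
    {σ V ξ ε : ℝ} (hσ : 0 < σ)
    (hsep : ∀ i ∈ Finset.range (D + 1), ∀ j ∈ Finset.range (D + 1), i ≠ j → σ ≤ ‖v i - v j‖)
    (hV : ∀ i ∈ Finset.range (D + 1), ‖v i‖ ≤ V)
    (hε : ∀ i ∈ Finset.range (D + 1), ‖f.eval (v i)‖ ≤ ε) {x : ℂ} (hx : ‖x‖ ≤ ξ) :
    ‖f.eval x‖ ≤ (D + 1) * ((ξ + V) / σ) ^ D * ε := by
  classical
  set s : Finset ℕ := Finset.range (D + 1) with hs
  have hinj : Set.InjOn v s := by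
    intro i hi j hj hij
    by_contra hne
    have := hsep i hi j hj hne
    rw [hij, sub_self, norm_zero] at this
    exact absurd this (not_le.2 hσ)
  have hdeg : f.degree < s.card := by
    rw [hs, Finset.card_range]
    exact lt_of_le_of_lt (Polynomial.degree_le_of_natDegree_le hf) (by exact_mod_cast Nat.lt_succ_self D)
  have hint := Lagrange.eq_interpolate (v := v) hinj hdeg
  have hε0 : 0 ≤ ε := (norm_nonneg _).trans (hε 0 (by simp [hs]))
  -- bound on each Lagrange basis polynomial at `x`
  have hbasis : ∀ i ∈ s, ‖(Lagrange.basis s v i).eval x‖ ≤ ((ξ + V) / σ) ^ D := by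
    intro i hi
    rw [Lagrange.basis, Polynomial.eval_prod, norm_prod]
    have hcard : (s.erase i).card = D := by rw [Finset.card_erase_of_mem hi, hs, Finset.card_range]; rfl
    calc ∏ j ∈ s.erase i, ‖(Lagrange.basisDivisor (v i) (v j)).eval x‖
        ≤ ∏ _j ∈ s.erase i, (ξ + V) / σ := by
          refine Finset.prod_le_prod (fun j _ => norm_nonneg _) fun j hj => ?_
          have hji : j ≠ i := (Finset.mem_erase.1 hj).1
          have hjs : j ∈ s := (Finset.mem_erase.1 hj).2
          rw [Lagrange.basisDivisor, Polynomial.eval_mul, Polynomial.eval_C, Polynomial.eval_sub,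
            Polynomial.eval_X, Polynomial.eval_C, norm_mul, norm_inv]
          have h1 : σ ≤ ‖v i - v j‖ := hsep i hi j hjs (Ne.symm hji)
          have h2 : ‖x - v j‖ ≤ ξ + V := (norm_sub_le _ _).trans (add_le_add hx (hV j hjs))
          rw [div_eq_inv_mul]
          have h3 : ‖v i - v j‖⁻¹ ≤ σ⁻¹ := by
            rw [inv_le_inv₀ (hσ.trans_le h1) hσ]; exact h1
          exact mul_le_mul h3 h2 (norm_nonneg _) (inv_nonneg.2 hσ.le)
      _ = ((ξ + V) / σ) ^ D := by rw [Finset.prod_const, hcard]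
  have heval : f.eval x = ∑ i ∈ s, f.eval (v i) * (Lagrange.basis s v i).eval x := by
    conv_lhs => rw [hint]
    rw [Lagrange.interpolate_apply, Polynomial.eval_finsetSum]
    refine Finset.sum_congr rfl fun i _ => ?_
    rw [Polynomial.eval_mul, Polynomial.eval_C]
  rw [heval]
  calc ‖∑ i ∈ s, f.eval (v i) * (Lagrange.basis s v i).eval x‖
      ≤ ∑ i ∈ s, ‖f.eval (v i) * (Lagrange.basis s v i).eval x‖ := norm_sum_le _ _
    _ ≤ ∑ _i ∈ s, ε * ((ξ + V) / σ) ^ D := by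
        refine Finset.sum_le_sum fun i hi => ?_
        rw [norm_mul]
        exact mul_le_mul (hε i hi) (hbasis i hi) (norm_nonneg _) hε0
    _ = (D + 1) * ((ξ + V) / σ) ^ D * ε := by
        rw [Finset.sum_const, hs, Finset.card_range, nsmul_eq_mul]
        push_cast
        ring

/-- Separation of the geometric nodes `β^i`, `0 ≤ i ≤ D`, from a lower bound for `|β^j - 1|`,
`1 ≤ j ≤ D`: `|β^i - β^j| ≥ min(1,|β|)^D δ`. [folklore] -/
theorem norm_pow_sub_pow_ge {β : ℂ} {D : ℕ} {δ : ℝ} (hδ : 0 ≤ δ)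
    (h : ∀ j : ℕ, 1 ≤ j → j ≤ D → δ ≤ ‖β ^ j - 1‖) {i j : ℕ} (hi : i ≤ D) (hj : j ≤ D)
    (hij : i ≠ j) : (min 1 ‖β‖) ^ D * δ ≤ ‖β ^ i - β ^ j‖ := by
  have hb0 : 0 ≤ min 1 ‖β‖ := le_min zero_le_one (norm_nonneg _)
  have hb1 : min 1 ‖β‖ ≤ 1 := min_le_left _ _
  -- reduce to `i < j`
  wlog hlt : i < j generalizing i j
  · have := this hj hi (Ne.symm hij) (lt_of_le_of_ne (not_lt.1 hlt) (Ne.symm hij))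
    rwa [norm_sub_rev] at this
  have hfac : β ^ i - β ^ j = β ^ i * (1 - β ^ (j - i)) := by
    rw [mul_sub, mul_one, ← pow_add, Nat.add_sub_cancel' hlt.le]
  rw [hfac, norm_mul, norm_sub_rev, norm_pow]
  have h1 : (min 1 ‖β‖) ^ D ≤ ‖β‖ ^ i :=
    (pow_le_pow_of_le_one hb0 hb1 hi).trans (pow_le_pow_left₀ hb0 (min_le_right _ _) i)
  have h2 : δ ≤ ‖β ^ (j - i) - 1‖ := h (j - i) (by omega) (by omega)
  exact mul_le_mul h1 h2 hδ (pow_nonneg (norm_nonneg _) _)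

/-- `|‖β‖ - 1| ≤ |β^j - 1|` for all `j ≥ 1` (useful when `‖β‖ ≠ 1`). [folklore] -/
theorem abs_norm_sub_one_le_norm_pow_sub_one (β : ℂ) {j : ℕ} (hj : 1 ≤ j) :
    |‖β‖ - 1| ≤ ‖β ^ j - 1‖ := by
  have h1 : |‖β ^ j‖ - ‖(1 : ℂ)‖| ≤ ‖β ^ j - 1‖ := abs_norm_sub_norm_le _ _
  rw [norm_one, norm_pow] at h1
  refine le_trans ?_ h1
  have hj0 : j ≠ 0 := by omega
  rcases le_or_gt 1 ‖β‖ with hb | hb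
  · have : ‖β‖ ≤ ‖β‖ ^ j := le_self_pow₀ hb hj0
    rw [abs_of_nonneg (by linarith), abs_of_nonneg (by linarith)]
    linarith
  · have : ‖β‖ ^ j ≤ ‖β‖ := pow_le_of_le_one (norm_nonneg _) hb.le hj0
    rw [abs_of_neg (by linarith), abs_of_nonpos (by linarith)]
    linarith




/-! ### The slice `X ↦ Q(z, c X)` -/

/-- Evaluation of the one-variable slice `X ↦ Q(z, c X)` of `Q ∈ ℤ[X₀, X₁]`, written as the
complex polynomial `∑_m Q_m z^{m₀} c^{m₁} X^{m₁}` (Roy 2001, p. 191: "a polynomial in `e^z`").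
[cite: Roy2001, §4 (p. 191)] -/
theorem eval_sum_monomial_slice (Q : MvPolynomial (Fin 2) ℤ) (z c x : ℂ) :
    (∑ m ∈ Q.support, Polynomial.monomial (m 1)
        (((coeff m Q : ℤ) : ℂ) * z ^ (m 0) * c ^ (m 1))).eval x = aeval ![z, c * x] Q := by
  conv_rhs => rw [Q.as_sum, map_sum]
  rw [Polynomial.eval_finsetSum]
  refine Finset.sum_congr rfl fun m _ => ?_
  rw [Polynomial.eval_monomial, aeval_monomial_two, mul_pow]
  ring

/-- The slice `X ↦ Q(z, c X)` has degree `≤ deg₁ Q`. [cite: Roy2001, §4 (p. 191)] -/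
theorem natDegree_sum_monomial_slice_le (Q : MvPolynomial (Fin 2) ℤ) (z c : ℂ) :
    (∑ m ∈ Q.support, Polynomial.monomial (m 1)
        (((coeff m Q : ℤ) : ℂ) * z ^ (m 0) * c ^ (m 1))).natDegree ≤ Q.degreeOf 1 := by
  refine Polynomial.natDegree_sum_le_of_forall_le _ _ fun m hm => ?_
  exact (Polynomial.natDegree_monomial_le _).trans ((degreeOf_le_iff.1 le_rfl) m hm)

/-! ### Separation of the nodes `β^j` on the unit circle (from Lemma 4) -/

/-- On the unit circle: `|e^{2πi x} - 1| = 2|sin(π x)| ≥ 4 |x - round x|` (Jordan's inequality).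
[folklore] -/
theorem four_mul_abs_sub_round_le (x : ℝ) :
    4 * |x - round x| ≤ ‖cexp (2 * Real.pi * I * x) - 1‖ := by
  set w : ℝ := x - round x with hw
  have hw2 : |w| ≤ 1 / 2 := abs_sub_round x
  have hx : (x : ℂ) = (w : ℂ) + ((round x : ℤ) : ℂ) := by
    rw [hw]; push_cast; ring
  have hper : cexp (2 * Real.pi * I * x) = cexp (I * ((2 * Real.pi * w : ℝ) : ℂ)) := by
    rw [hx, mul_add, Complex.exp_add]
    have : cexp (2 * ↑Real.pi * I * ((round x : ℤ) : ℂ)) = 1 := by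
      rw [show 2 * ↑Real.pi * I * ((round x : ℤ) : ℂ) = ((round x : ℤ) : ℂ) * (2 * Real.pi * I) by
        ring]
      exact Complex.exp_int_mul_two_pi_mul_I (round x)
    rw [this, mul_one]
    congr 1
    push_cast; ring
  rw [hper, Complex.norm_exp_I_mul_ofReal_sub_one]
  have hsin : 2 / Real.pi * |Real.pi * w| ≤ |Real.sin (Real.pi * w)| := by
    apply Real.mul_abs_le_abs_sin
    rw [abs_mul, abs_of_pos Real.pi_pos]
    calc Real.pi * |w| ≤ Real.pi * (1 / 2) := by gcongr
      _ = Real.pi / 2 := by ring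
  have harg : 2 * Real.pi * w / 2 = Real.pi * w := by ring
  rw [harg, Real.norm_eq_abs, abs_mul, abs_of_pos (by norm_num : (0 : ℝ) < 2)]
  rw [abs_mul, abs_of_pos Real.pi_pos] at hsin
  have : 2 / Real.pi * (Real.pi * |w|) = 2 * |w| := by field_simp
  rw [this] at hsin
  linarith

/-- If `‖β‖ = 1` then `β^j = e^{2πi j a}` with `a = arg β / (2π)`. [folklore] -/
theorem pow_eq_exp_of_norm_eq_one {β : ℂ} (hβ : ‖β‖ = 1) (j : ℕ) :
    β ^ j = cexp (2 * Real.pi * I * ((j * (arg β / (2 * Real.pi)) : ℝ) : ℂ)) := by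
  have h1 : β = cexp (arg β * I) := by
    have := Complex.norm_mul_exp_arg_mul_I β
    rw [hβ] at this
    simpa using this.symm
  conv_lhs => rw [h1]
  rw [← Complex.exp_nat_mul]
  congr 1
  have hπ : (Real.pi : ℂ) ≠ 0 := by exact_mod_cast Real.pi_ne_zero
  push_cast
  field_simp

/-- Case `‖β‖ = 1` of the node separation: from condition (7) of Roy's Lemma 4 at level `N` for
`a = arg β / (2π)`, `|β^j - 1| ≥ 2/N` for `1 ≤ j < N` with `j|a| + 1 ≤ N` (Roy 2001, p. 192,
the role of (7) in the proof of Prop. 3). [cite: Roy2001, Lemma 4 / Prop. 3 (p. 192)] -/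
theorem two_div_le_norm_pow_sub_one {β : ℂ} (hβ : ‖β‖ = 1) {N : ℕ}
    (hsep : ∀ m n : ℤ, (m ≠ 0 ∨ n ≠ 0) → |m| < N → |n| < N →
      1 / (2 * (N : ℝ)) ≤ ‖(m : ℂ) + n * (((arg β / (2 * Real.pi) : ℝ)) : ℂ)‖)
    {j : ℕ} (hj1 : 1 ≤ j) (hjN : j < N) (hja : j * |arg β / (2 * Real.pi)| + 1 ≤ N) :
    2 / (N : ℝ) ≤ ‖β ^ j - 1‖ := by
  set a : ℝ := arg β / (2 * Real.pi) with ha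
  set x : ℝ := j * a with hx
  rw [pow_eq_exp_of_norm_eq_one hβ j]
  refine le_trans ?_ (four_mul_abs_sub_round_le x)
  -- apply (7) with `m = -round x`, `n = j`
  have hm : |(-round x : ℤ)| < N := by
    rw [abs_neg]
    have h1 : |(round x : ℝ)| ≤ |x| + 1 / 2 := by
      have := abs_sub_round x
      have h' : |(round x : ℝ)| ≤ |x| + |x - round x| := by
        calc |(round x : ℝ)| = |x - (x - round x)| := by ring_nf
          _ ≤ |x| + |x - round x| := abs_sub _ _
      linarith
    have h2 : |x| ≤ j * |a| := by rw [hx, abs_mul, Nat.abs_cast]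
    have h3 : ((|round x| : ℤ) : ℝ) < N := by
      rw [Int.cast_abs]; linarith
    exact_mod_cast h3
  have hn : |(j : ℤ)| < N := by
    rw [Nat.abs_cast]; exact_mod_cast hjN
  have h7 := hsep (-round x) j (Or.inr (by exact_mod_cast (show j ≠ 0 by omega))) hm hn
  have hnorm : ‖((-round x : ℤ) : ℂ) + ((j : ℤ) : ℂ) * ((a : ℝ) : ℂ)‖ = |x - round x| := by
    have : ((-round x : ℤ) : ℂ) + ((j : ℤ) : ℂ) * ((a : ℝ) : ℂ) = ((x - round x : ℝ) : ℂ) := by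
      rw [hx]; push_cast; ring
    rw [this, Complex.norm_real, Real.norm_eq_abs]
  rw [hnorm] at h7
  have hN : (0 : ℝ) < N := by exact_mod_cast (show 0 < N by omega)
  calc 2 / (N : ℝ) = 4 * (1 / (2 * (N : ℝ))) := by field_simp; ring
    _ ≤ 4 * |x - round x| := by gcongr

/-- If no positive power of `β` is `1` and `‖β‖ = 1`, then `a = arg β / (2π)` is irrational
(Roy 2001, p. 192: "the ratio `a = (λ - y)/(2πi)` is by hypothesis an irrational number").
[cite: Roy2001, Prop. 3 (proof, p. 192)] -/
theorem forall_ratCast_ne_arg_div {β : ℂ} (hβ : ‖β‖ = 1) (h : ∀ d : ℕ, 1 ≤ d → β ^ d ≠ 1) :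
    ∀ q : ℚ, (q : ℂ) ≠ (((arg β / (2 * Real.pi) : ℝ)) : ℂ) := by
  intro q hq
  apply h q.den q.pos
  rw [pow_eq_exp_of_norm_eq_one hβ]
  have hq' : (q : ℝ) = arg β / (2 * Real.pi) := by
    have : ((q : ℝ) : ℂ) = (((arg β / (2 * Real.pi) : ℝ)) : ℂ) := by rw [← hq]; push_cast; rfl
    exact_mod_cast this
  rw [← hq']
  have hqd : (q.den : ℝ) * (q : ℝ) = (q.num : ℝ) := by
    have := Rat.mul_den_eq_num q
    rw [mul_comm]; exact_mod_cast this
  rw [hqd]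
  have : 2 * ↑Real.pi * I * (((q.num : ℝ)) : ℂ) = (q.num : ℂ) * (2 * Real.pi * I) := by
    push_cast; ring
  rw [this]
  exact Complex.exp_int_mul_two_pi_mul_I q.num


/-- Numerical bookkeeping for the proof of Proposition 3: for large `x`, the exponents produced
by `prop3_taylor`/`prop3_smallness` are dominated by `x^u` and by `(log 2) x^{s₀}` because
`t₁ < u`, `2t₁ < u` and `1, t₀, t₁, 2t₁ < s₀` (Roy 2001, p. 193). [cite: Roy2001, Prop. 3 (proof, p. 193)] -/
theorem eventually_prop3_numerics {s₀ t₀ t₁ u : ℝ} (hu : 0 < u) (hs₀ : 0 < s₀) (ht₁ : 0 ≤ t₁)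
    (ht₁u : t₁ < u) (h2t₁u : 2 * t₁ < u) (ht₁s₀ : t₁ < s₀) (h2t₁s₀ : 2 * t₁ < s₀)
    (ht₀s₀ : t₀ < s₀) (h1s₀ : 1 < s₀) {c₁ c₂ c₃ c₄ c₅ : ℝ} (hc₃ : 0 ≤ c₃) :
    ∀ᶠ x : ℝ in atTop, 1 ≤ x ∧
      2 + c₁ * x ^ t₁ + c₂ * (x ^ t₁) ^ 2 + c₃ * (x ^ t₁ * Real.log x) ≤ x ^ u ∧
      2 + 6 * x ^ t₁ + c₄ * (x ^ t₁) ^ 2 + c₃ * (x ^ t₁ * Real.log x) + c₅ * x ^ t₀ +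
        t₁ * (x ^ t₀ * Real.log x) + x ≤ Real.log 2 * x ^ s₀ := by
  have q0 : (0 : ℝ) < 1 / 4 := by norm_num
  set q : ℝ := Real.log 2 / 8 with hq
  have hq0 : 0 < q := by rw [hq]; exact div_pos (Real.log_pos one_lt_two) (by norm_num)
  filter_upwards [eventually_ge_atTop (1 : ℝ),
    eventually_const_le_mul_rpow 2 hu q0,
    eventually_mul_rpow_le_mul_rpow c₁ ht₁u q0,
    eventually_mul_rpow_le_mul_rpow c₂ h2t₁u q0,
    eventually_mul_rpow_mul_log_le ht₁u hc₃ q0,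
    eventually_const_le_mul_rpow 2 hs₀ hq0,
    eventually_mul_rpow_le_mul_rpow 6 ht₁s₀ hq0,
    eventually_mul_rpow_le_mul_rpow c₄ h2t₁s₀ hq0,
    eventually_mul_rpow_mul_log_le ht₁s₀ hc₃ hq0,
    eventually_mul_rpow_le_mul_rpow c₅ ht₀s₀ hq0,
    eventually_mul_rpow_mul_log_le ht₀s₀ ht₁ hq0,
    eventually_mul_rpow_le_mul_rpow 1 h1s₀ hq0]
    with x hx1 A1 A2 A3 A4 B1 B2 B3 B4 B5 B6 B7
  have hx0 : 0 < x := one_pos.trans_le hx1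
  have h2 : x ^ (2 * t₁) = (x ^ t₁) ^ 2 := by rw [two_mul, Real.rpow_add hx0, sq]
  rw [h2] at A3 B3
  rw [Real.rpow_one, one_mul] at B7
  refine ⟨hx1, ?_, ?_⟩
  · linarith [A1, A2, A3, A4]
  · have : Real.log 2 * x ^ s₀ = 8 * (q * x ^ s₀) := by rw [hq]; ring
    rw [this]
    linarith [B1, B2, B3, B4, B5, B6, B7]

/-! ### Proposition 3 -/

/-- **Step 1** of the proof of Proposition 3 (Taylor expansion along `w = (1,1)`, replacing the
`D_w`-derivative data fed into Theorem 2 on p. 193): if `|(D^k Q)(ny, α^n)| ≤ ε₀` for `k < L`,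
then `|Q(ny + t, α^n e^t)| ≤ ε₀ e^ρ + 2·2^{-L} C` for `|t| ≤ ρ`, where
`C = (D₀+1)(D₁+1) H(Q) (3ρ)^{D₀} (A^{D₁} e^{2ρ})^{D₁}` bounds `|Q(ny + t, α^n e^t)|` on `|t| = 2ρ`
(Roy's "`|F|_R ≤ (M^{t₀}+1)(M^{t₁}+1) exp(M + M^{t₀} log R + R M^{t₁})`", p. 193).
[cite: Roy2001, Prop. 3 (proof, p. 193)] -/
theorem prop3_taylor {y α : ℂ} (Q : MvPolynomial (Fin 2) ℤ) {D₀ D₁ L n : ℕ}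
    (hD₀ : Q.degreeOf 0 ≤ D₀) (hD₁ : Q.degreeOf 1 ≤ D₁) (hn : n ≤ D₁) {ρ ε₀ A : ℝ}
    (hρ : 1 + D₁ * ‖y‖ ≤ ρ) (hε₀ : 0 ≤ ε₀) (hA : ‖α‖ ≤ A) (hA1 : 1 ≤ A)
    (hsmall : ∀ k : ℕ, k < L → ‖aeval ![(n : ℂ) * y, α ^ n] (royD^[k] Q)‖ ≤ ε₀)
    {t : ℂ} (ht : ‖t‖ ≤ ρ) :
    ‖aeval ![(n : ℂ) * y + t, α ^ n * cexp t] Q‖ ≤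
      ε₀ * Real.exp ρ + 2 * (1 / 2) ^ L *
        ((((D₀ + 1) * (D₁ + 1) : ℕ) : ℝ) * mvPolyHeight Q * (3 * ρ) ^ D₀ *
          (A ^ D₁ * Real.exp (2 * ρ)) ^ D₁) := by
  have hy0 : 0 ≤ ‖y‖ := norm_nonneg _
  have hDy : 0 ≤ (D₁ : ℝ) * ‖y‖ := by positivity
  have hρ1 : 1 ≤ ρ := by linarith
  have hρ0 : 0 < ρ := one_pos.trans_le hρ1
  refine norm_le_of_norm_iteratedDeriv_le (f := fun s => aeval ![(n : ℂ) * y + s, α ^ n * cexp s] Q)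
    (fun s => (hasDerivAt_aeval_add_mul_exp Q _ _ s).differentiableAt) (L := L) hρ0 hε₀ ?_ ?_ ht
  · intro k hk
    rw [iteratedDeriv_aeval_add_mul_exp]
    simpa using hsmall k hk
  · intro w hw
    have hw' : ‖w‖ = 2 * ρ := by simpa using hw
    show ‖aeval ![(n : ℂ) * y + w, α ^ n * cexp w] Q‖ ≤ _
    refine norm_aeval_le_of_degreeOf_le Q hD₀ hD₁ _ _ ?_ ?_ (by linarith) ?_
    · calc ‖(n : ℂ) * y + w‖ ≤ ‖(n : ℂ) * y‖ + ‖w‖ := norm_add_le _ _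
        _ = n * ‖y‖ + 2 * ρ := by rw [norm_mul, Complex.norm_natCast, hw']
        _ ≤ D₁ * ‖y‖ + 2 * ρ := by gcongr
        _ ≤ 3 * ρ := by linarith
    · rw [norm_mul, norm_pow, Complex.norm_exp]
      have hαn : ‖α‖ ^ n ≤ A ^ D₁ :=
        (pow_le_pow_left₀ (norm_nonneg _) hA n).trans (pow_le_pow_right₀ hA1 hn)
      have hre : w.re ≤ 2 * ρ := (Complex.re_le_norm w).trans_eq hw'
      gcongr
    · exact one_le_mul_of_one_le_of_one_le (one_le_pow₀ hA1) (Real.one_le_exp (by linarith))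

/-- **Steps 2–3** of the proof of Proposition 3 (one-variable interpolation in place of
Theorem 2, and Roy's lower bound "`1 ≤ H(Q) ≤ |Q|₁ ≤ |F|_π`", p. 193): if
`|Q(ny + t, α^n e^t)| ≤ ε₁` for `n ≤ D₁`, `|t| ≤ ρ` (`ρ ≥ 1 + D₁|y|`), and the powers `β^j`
(`1 ≤ j ≤ D₁`) of `β = α e^{-y}` stay `≥ δ` away from `1`, then Lagrange interpolation of
`X ↦ Q(z, e^z X)` at the nodes `β^n` and Cauchy's inequality for the coefficients give
`1 ≤ (D₁+1) ((e + B^{D₁})/(b^{D₁} δ))^{D₁} ε₁` (`|β| ≤ B`, `1 ≤ B`, `0 < b ≤ min(1, |β|)`).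
[cite: Roy2001, Prop. 3 (proof, p. 193)] -/
theorem prop3_smallness {y α : ℂ} {Q : MvPolynomial (Fin 2) ℤ} (hQ : Q ≠ 0)
    {D₁ : ℕ} (hD₁ : Q.degreeOf 1 ≤ D₁) {ρ ε₁ δ B b : ℝ} (hρ : 1 + D₁ * ‖y‖ ≤ ρ) (hδ : 0 < δ)
    (hB : ‖α * cexp (-y)‖ ≤ B) (hB1 : 1 ≤ B) (hb : b ≤ min 1 ‖α * cexp (-y)‖) (hb0 : 0 < b)
    (hsep : ∀ j : ℕ, 1 ≤ j → j ≤ D₁ → δ ≤ ‖(α * cexp (-y)) ^ j - 1‖)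
    (hstep1 : ∀ n : ℕ, n ≤ D₁ → ∀ t : ℂ, ‖t‖ ≤ ρ →
      ‖aeval ![(n : ℂ) * y + t, α ^ n * cexp t] Q‖ ≤ ε₁) :
    1 ≤ ((D₁ : ℝ) + 1) * ((Real.exp 1 + B ^ D₁) / (b ^ D₁ * δ)) ^ D₁ * ε₁ := by
  set β : ℂ := α * cexp (-y) with hβdef
  have hσ0 : 0 < b ^ D₁ * δ := mul_pos (pow_pos hb0 _) hδ
  -- Step 2: interpolation of `X ↦ Q(z, e^z X)` at the nodes `β^i`, `0 ≤ i ≤ D₁`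
  have step2 : ∀ z : ℂ, ‖z‖ ≤ 1 → ∀ x : ℂ, ‖x‖ ≤ Real.exp 1 →
      ‖(∑ m ∈ Q.support, Polynomial.monomial (m 1)
          (((coeff m Q : ℤ) : ℂ) * z ^ (m 0) * cexp z ^ (m 1))).eval x‖ ≤
        ((D₁ : ℝ) + 1) * ((Real.exp 1 + B ^ D₁) / (b ^ D₁ * δ)) ^ D₁ * ε₁ := by
    intro z hz x hx
    refine norm_eval_le_of_nodes (D := D₁) _ ((natDegree_sum_monomial_slice_le Q z _).trans hD₁)
      (fun i => β ^ i) hσ0 ?_ ?_ ?_ hx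
    · intro i hi j hj hij
      have hb0' : 0 ≤ b := hb0.le
      calc b ^ D₁ * δ ≤ (min 1 ‖β‖) ^ D₁ * δ := by gcongr
        _ ≤ ‖β ^ i - β ^ j‖ := norm_pow_sub_pow_ge hδ.le hsep
            (Nat.lt_succ_iff.1 (Finset.mem_range.1 hi)) (Nat.lt_succ_iff.1 (Finset.mem_range.1 hj))
            hij
    · intro i hi
      rw [norm_pow]
      exact (pow_le_pow_left₀ (norm_nonneg _) hB i).trans
        (pow_le_pow_right₀ hB1 (Nat.lt_succ_iff.1 (Finset.mem_range.1 hi)))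
    · intro i hi
      have hiD : i ≤ D₁ := Nat.lt_succ_iff.1 (Finset.mem_range.1 hi)
      rw [eval_sum_monomial_slice]
      show ‖aeval ![z, cexp z * β ^ i] Q‖ ≤ ε₁
      have e1 : (i : ℂ) * y + (z - i * y) = z := by ring
      have e2 : α ^ i * cexp (z - i * y) = cexp z * β ^ i := by
        rw [show z - (i : ℂ) * y = z + (i : ℂ) * (-y) by ring, Complex.exp_add, hβdef, mul_pow,
          ← Complex.exp_nat_mul]
        ring
      have hti : ‖z - (i : ℂ) * y‖ ≤ ρ := by
        calc ‖z - (i : ℂ) * y‖ ≤ ‖z‖ + ‖(i : ℂ) * y‖ := norm_sub_le _ _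
          _ = ‖z‖ + i * ‖y‖ := by rw [norm_mul, Complex.norm_natCast]
          _ ≤ 1 + D₁ * ‖y‖ := by
              have hiD' : (i : ℝ) ≤ D₁ := by exact_mod_cast hiD
              gcongr
          _ ≤ ρ := hρ
      have := hstep1 i hiD (z - i * y) hti
      rwa [e1, e2] at this
  -- Step 3: `1 ≤ H(Q) ≤ sup_{|ζ| = 1} |Q(ζ^{D₁+1}, ζ)|`, and `Q(ζ^{D₁+1}, ζ)` is a value of a slice
  refine one_le_of_forall_norm_aeval_le Q hQ (K := D₁ + 1) (Nat.lt_succ_of_le hD₁) fun ζ hζ => ?_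
  have hz : ‖ζ ^ (D₁ + 1)‖ = 1 := by simp [hζ]
  have hx : ‖ζ * cexp (-ζ ^ (D₁ + 1))‖ ≤ Real.exp 1 := by
    rw [norm_mul, hζ, one_mul, Complex.norm_exp]
    exact Real.exp_le_exp.2 ((Complex.re_le_norm _).trans (by rw [norm_neg, hz]))
  have := step2 (ζ ^ (D₁ + 1)) hz.le (ζ * cexp (-ζ ^ (D₁ + 1))) hx
  rwa [eval_sum_monomial_slice, show cexp (ζ ^ (D₁ + 1)) * (ζ * cexp (-ζ ^ (D₁ + 1))) = ζ by
    rw [Complex.exp_neg]; field_simp] at this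

/-- `2 · 2^{-L} ≤ e^{1 - (log 2) S₀}` when `S₀ ≤ L` (the gain from `⌊M^{s₀}⌋ + 1` small Taylor
coefficients). [folklore] -/
theorem two_mul_half_pow_le_exp {L : ℕ} {S₀ : ℝ} (hS₀L : S₀ ≤ L) :
    2 * (1 / 2 : ℝ) ^ L ≤ Real.exp (1 - Real.log 2 * S₀) := by
  have h2e : (2 : ℝ) ≤ Real.exp 1 := by
    have := Real.add_one_le_exp (1 : ℝ); norm_num at this; exact this
  have hp : (1 / 2 : ℝ) ^ L = Real.exp (-(L * Real.log 2)) := by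
    rw [← Real.exp_log (by norm_num : (0 : ℝ) < 1 / 2), ← Real.exp_nat_mul, one_div,
      Real.log_inv]
    ring_nf
  rw [hp, sub_eq_add_neg, Real.exp_add]
  refine mul_le_mul h2e (Real.exp_le_exp.2 ?_) (Real.exp_pos _).le (Real.exp_pos _).le
  have h2 := Real.log_pos one_lt_two
  nlinarith

/-- **Step 4** of the proof of Proposition 3 (the exponent bookkeeping of Roy 2001, p. 193, for
the one-variable route): with `T₀ = M^{t₀}`, `T₁ = M^{t₁}`, `S₀ = M^{s₀}`, `U = M^u`,
`ℓ = log M`, `H(Q) ≤ e^M`, `δ⁻¹ ≤ M^κ`, the quantity bounded below by `1` in `prop3_smallness`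
(fed with `prop3_taylor`, `ε₀ = e^{-U}`, `L = ⌊S₀⌋ + 1`, `ρ = 1 + T₁ |y|`) is `< 1` as soon as
the two inequalities `hX1`, `hX2` produced by `eventually_prop3_numerics` hold.
[cite: Roy2001, Prop. 3 (proof, p. 193)] -/
theorem prop3_numeric {D₀ D₁ L : ℕ} {T₀ T₁ S₀ U M ℓ cy κ t₁ δ B b A H : ℝ}
    (hT₀0 : 0 ≤ T₀) (hT₁1 : 1 ≤ T₁) (hℓ0 : 0 ≤ ℓ) (hcy0 : 0 ≤ cy) (hκ0 : 0 ≤ κ)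
    (hD₀T : (D₀ : ℝ) ≤ T₀) (hD₁T : (D₁ : ℝ) ≤ T₁) (hS₀L : S₀ ≤ L)
    (hlogT₁ : Real.log T₁ = t₁ * ℓ) (hH0 : 0 ≤ H) (hHM : H ≤ Real.exp M) (hδ0 : 0 < δ)
    (hδinv : δ⁻¹ ≤ Real.exp (κ * ℓ)) (hB1 : 1 ≤ B) (hb0 : 0 < b) (hb1 : b ≤ 1) (hA1 : 1 ≤ A)
    (hX1 : 2 + (3 + cy) * T₁ + (Real.log B + Real.log b⁻¹) * T₁ ^ 2 + κ * (T₁ * ℓ) ≤ U)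
    (hX2 : 2 + 6 * T₁ + (Real.log B + Real.log b⁻¹ + Real.log A + 2 * cy) * T₁ ^ 2 +
        κ * (T₁ * ℓ) + (1 + Real.log (3 * (1 + cy))) * T₀ + t₁ * (T₀ * ℓ) + M ≤
      Real.log 2 * S₀) :
    ((D₁ : ℝ) + 1) * ((Real.exp 1 + B ^ D₁) / (b ^ D₁ * δ)) ^ D₁ *
        (Real.exp (-U) * Real.exp (1 + T₁ * cy) + 2 * (1 / 2) ^ L *
          ((((D₀ + 1) * (D₁ + 1) : ℕ) : ℝ) * H * (3 * (1 + T₁ * cy)) ^ D₀ *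
            (A ^ D₁ * Real.exp (2 * (1 + T₁ * cy))) ^ D₁)) < 1 := by
  -- abbreviations
  set ρ : ℝ := 1 + T₁ * cy with hρdef
  set LB : ℝ := Real.log B with hLB
  set Lb : ℝ := Real.log b⁻¹ with hLb
  set La : ℝ := Real.log A with hLa
  set c3 : ℝ := Real.log (3 * (1 + cy)) with hc3
  set Cbig : ℝ := (((D₀ + 1) * (D₁ + 1) : ℕ) : ℝ) * H * (3 * ρ) ^ D₀ *
    (A ^ D₁ * Real.exp (2 * ρ)) ^ D₁ with hCbig
  set ε₁ : ℝ := Real.exp (-U) * Real.exp ρ + 2 * (1 / 2) ^ L * Cbig with hε₁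
  set σ : ℝ := b ^ D₁ * δ with hσ
  set Λ : ℝ := ((Real.exp 1 + B ^ D₁) / σ) ^ D₁ with hΛ
  have hT₁0 : 0 ≤ T₁ := zero_le_one.trans hT₁1
  have hLB0 : 0 ≤ LB := Real.log_nonneg hB1
  have hLb0 : 0 ≤ Lb := Real.log_nonneg (one_le_inv_iff₀.2 ⟨hb0, hb1⟩)
  have hLa0 : 0 ≤ La := Real.log_nonneg hA1
  have hc30 : 0 ≤ c3 := Real.log_nonneg (by linarith only [hcy0])
  have hρ1 : 1 ≤ ρ := by have := mul_nonneg hT₁0 hcy0; linarith only [this, hρdef]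
  have hρ0 : 0 < ρ := one_pos.trans_le hρ1
  have hσ0 : 0 < σ := mul_pos (pow_pos hb0 _) hδ0
  -- (c1) `D₁ + 1 ≤ e^{T₁}`
  have c1 : (D₁ + 1 : ℝ) ≤ Real.exp T₁ := by
    have := Real.add_one_le_exp T₁; linarith only [this, hD₁T]
  -- exponential renderings of powers
  have hpow_exp : ∀ {x : ℝ} (_ : 0 < x) (n : ℕ), x ^ n = Real.exp (n * Real.log x) := by
    intro x hx n; rw [Real.exp_nat_mul, Real.exp_log hx]
  have hDexp : ∀ {n : ℕ} {T c : ℝ}, (n : ℝ) ≤ T → 0 ≤ c → Real.exp (n * c) ≤ Real.exp (T * c) :=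
    fun hn hc => Real.exp_le_exp.2 (mul_le_mul_of_nonneg_right hn hc)
  -- (c2) `Λ ≤ exp(T₁ a)` with `a = 2 + T₁ (LB + Lb) + κ ℓ`
  have hnum : Real.exp 1 + B ^ D₁ ≤ Real.exp (2 + T₁ * LB) := by
    have hBD : B ^ D₁ ≤ Real.exp (T₁ * LB) := by
      rw [hpow_exp (zero_lt_one.trans_le hB1)]; exact hDexp hD₁T hLB0
    have h2e : (2 : ℝ) ≤ Real.exp 1 := by
      have := Real.add_one_le_exp (1 : ℝ); norm_num at this; exact this
    have hE1 : 1 ≤ Real.exp (T₁ * LB) := Real.one_le_exp (mul_nonneg hT₁0 hLB0)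
    have hE0 : 0 ≤ Real.exp 1 := (Real.exp_pos 1).le
    calc Real.exp 1 + B ^ D₁
        ≤ Real.exp 1 * Real.exp (T₁ * LB) + Real.exp 1 * Real.exp (T₁ * LB) := by
          apply add_le_add
          · exact le_mul_of_one_le_right hE0 hE1
          · exact hBD.trans (le_mul_of_one_le_left (Real.exp_pos _).le (by linarith only [h2e]))
      _ = 2 * Real.exp 1 * Real.exp (T₁ * LB) := by ring
      _ ≤ Real.exp 1 * Real.exp 1 * Real.exp (T₁ * LB) := by gcongr
      _ = Real.exp (2 + T₁ * LB) := by rw [← Real.exp_add, ← Real.exp_add]; norm_num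
  have hden : σ⁻¹ ≤ Real.exp (T₁ * Lb + κ * ℓ) := by
    have hbD : (b ^ D₁)⁻¹ ≤ Real.exp (T₁ * Lb) := by
      rw [← inv_pow, hpow_exp (inv_pos.2 hb0)]; exact hDexp hD₁T hLb0
    rw [hσ, mul_inv, Real.exp_add]
    exact mul_le_mul hbD hδinv (inv_nonneg.2 hδ0.le) (Real.exp_pos _).le
  have hbase : (Real.exp 1 + B ^ D₁) / σ ≤ Real.exp (2 + T₁ * (LB + Lb) + κ * ℓ) := by
    rw [div_eq_mul_inv, show 2 + T₁ * (LB + Lb) + κ * ℓ = (2 + T₁ * LB) + (T₁ * Lb + κ * ℓ) by ring,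
      Real.exp_add]
    exact mul_le_mul hnum hden (inv_nonneg.2 hσ0.le) (Real.exp_pos _).le
  have ha0 : 0 ≤ 2 + T₁ * (LB + Lb) + κ * ℓ := by positivity
  have c2 : Λ ≤ Real.exp (T₁ * (2 + T₁ * (LB + Lb) + κ * ℓ)) := by
    have hb0' : 0 ≤ (Real.exp 1 + B ^ D₁) / σ := by positivity
    calc Λ ≤ (Real.exp (2 + T₁ * (LB + Lb) + κ * ℓ)) ^ D₁ := pow_le_pow_left₀ hb0' hbase _
      _ = Real.exp (D₁ * (2 + T₁ * (LB + Lb) + κ * ℓ)) := (Real.exp_nat_mul _ _).symm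
      _ ≤ Real.exp (T₁ * (2 + T₁ * (LB + Lb) + κ * ℓ)) := hDexp hD₁T ha0
  -- (c3) `ε₁ ≤ exp(-U + ρ) + exp(1 - log 2 · S₀ + γ₀)`
  have hCbig' : Cbig ≤ Real.exp (T₀ + T₁ + M + T₀ * (c3 + t₁ * ℓ) + T₁ * (T₁ * La + 2 * ρ)) := by
    have f1 : (((D₀ + 1) * (D₁ + 1) : ℕ) : ℝ) ≤ Real.exp (T₀ + T₁) := by
      push_cast
      rw [Real.exp_add]
      refine mul_le_mul ?_ ?_ (by positivity) (Real.exp_pos _).le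
      · exact (Real.add_one_le_exp _).trans (Real.exp_le_exp.2 hD₀T)
      · exact (Real.add_one_le_exp _).trans (Real.exp_le_exp.2 hD₁T)
    have f3 : (3 * ρ) ^ D₀ ≤ Real.exp (T₀ * (c3 + t₁ * ℓ)) := by
      have h3ρ : 0 < 3 * ρ := by positivity
      have hlog : Real.log (3 * ρ) ≤ c3 + t₁ * ℓ := by
        have hle : 3 * ρ ≤ 3 * (1 + cy) * T₁ := by
          have h1 : (1 + cy) * T₁ = T₁ + T₁ * cy := by ring
          rw [hρdef, mul_assoc, h1]; linarith only [hT₁1]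
        calc Real.log (3 * ρ) ≤ Real.log (3 * (1 + cy) * T₁) := Real.log_le_log h3ρ hle
          _ = c3 + t₁ * ℓ := by
              rw [Real.log_mul (by positivity) (by positivity), hc3, hlogT₁]
      have hlog0 : 0 ≤ Real.log (3 * ρ) := Real.log_nonneg (by linarith only [hρ1])
      rw [hpow_exp h3ρ]
      exact (hDexp hD₀T hlog0).trans (Real.exp_le_exp.2 (mul_le_mul_of_nonneg_left hlog hT₀0))
    have f4 : (A ^ D₁ * Real.exp (2 * ρ)) ^ D₁ ≤ Real.exp (T₁ * (T₁ * La + 2 * ρ)) := by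
      have hin : A ^ D₁ * Real.exp (2 * ρ) ≤ Real.exp (T₁ * La + 2 * ρ) := by
        rw [Real.exp_add]
        refine mul_le_mul_of_nonneg_right ?_ (Real.exp_pos _).le
        rw [hpow_exp (zero_lt_one.trans_le hA1)]; exact hDexp hD₁T hLa0
      have hin0 : 0 ≤ A ^ D₁ * Real.exp (2 * ρ) := by positivity
      calc (A ^ D₁ * Real.exp (2 * ρ)) ^ D₁ ≤ (Real.exp (T₁ * La + 2 * ρ)) ^ D₁ :=
            pow_le_pow_left₀ hin0 hin _
        _ = Real.exp (D₁ * (T₁ * La + 2 * ρ)) := (Real.exp_nat_mul _ _).symm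
        _ ≤ Real.exp (T₁ * (T₁ * La + 2 * ρ)) := hDexp hD₁T (by positivity)
    rw [hCbig, show T₀ + T₁ + M + T₀ * (c3 + t₁ * ℓ) + T₁ * (T₁ * La + 2 * ρ) =
      (T₀ + T₁) + M + T₀ * (c3 + t₁ * ℓ) + T₁ * (T₁ * La + 2 * ρ) by ring, Real.exp_add,
      Real.exp_add, Real.exp_add]
    exact mul_le_mul (mul_le_mul (mul_le_mul f1 hHM hH0 (Real.exp_pos _).le) f3 (by positivity)
      (by positivity)) f4 (by positivity) (by positivity)
  have hhalf : 2 * (1 / 2 : ℝ) ^ L ≤ Real.exp (1 - Real.log 2 * S₀) := two_mul_half_pow_le_exp hS₀L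
  have c3' : ε₁ ≤ Real.exp (-U + ρ) +
      Real.exp (1 - Real.log 2 * S₀ + (T₀ + T₁ + M + T₀ * (c3 + t₁ * ℓ) + T₁ * (T₁ * La + 2 * ρ))) := by
    rw [hε₁, Real.exp_add (-U), Real.exp_add (1 - Real.log 2 * S₀)]
    refine add_le_add le_rfl ?_
    exact mul_le_mul hhalf hCbig' (by positivity) (Real.exp_pos _).le
  -- (c4) assemble
  have hΛ0 : 0 ≤ Λ := by positivity
  have hε₁0 : 0 ≤ ε₁ := by positivity
  have hlt : ((D₁ : ℝ) + 1) * Λ * ε₁ ≤ Real.exp (-1) + Real.exp (-1) := by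
    calc ((D₁ : ℝ) + 1) * Λ * ε₁ ≤ Real.exp T₁ * Real.exp (T₁ * (2 + T₁ * (LB + Lb) + κ * ℓ)) *
          (Real.exp (-U + ρ) + Real.exp (1 - Real.log 2 * S₀ +
            (T₀ + T₁ + M + T₀ * (c3 + t₁ * ℓ) + T₁ * (T₁ * La + 2 * ρ)))) :=
          mul_le_mul (mul_le_mul c1 c2 hΛ0 (Real.exp_pos _).le) c3' hε₁0 (by positivity)
      _ = Real.exp (T₁ + T₁ * (2 + T₁ * (LB + Lb) + κ * ℓ) + (-U + ρ)) +
          Real.exp (T₁ + T₁ * (2 + T₁ * (LB + Lb) + κ * ℓ) + (1 - Real.log 2 * S₀ +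
            (T₀ + T₁ + M + T₀ * (c3 + t₁ * ℓ) + T₁ * (T₁ * La + 2 * ρ)))) := by
          rw [mul_add, ← Real.exp_add, ← Real.exp_add, ← Real.exp_add]
      _ ≤ Real.exp (-1) + Real.exp (-1) := by
          have k1 : T₁ + T₁ * (2 + T₁ * (LB + Lb) + κ * ℓ) + (-U + ρ) =
              (2 + (3 + cy) * T₁ + (LB + Lb) * T₁ ^ 2 + κ * (T₁ * ℓ)) - U - 1 := by
            rw [hρdef]; ring
          have k2 : T₁ + T₁ * (2 + T₁ * (LB + Lb) + κ * ℓ) + (1 - Real.log 2 * S₀ +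
              (T₀ + T₁ + M + T₀ * (c3 + t₁ * ℓ) + T₁ * (T₁ * La + 2 * ρ))) =
              (2 + 6 * T₁ + (LB + Lb + La + 2 * cy) * T₁ ^ 2 + κ * (T₁ * ℓ) + (1 + c3) * T₀ +
                t₁ * (T₀ * ℓ) + M) - Real.log 2 * S₀ - 1 := by
            rw [hρdef]; ring
          have i1 : T₁ + T₁ * (2 + T₁ * (LB + Lb) + κ * ℓ) + (-U + ρ) ≤ -1 := by
            linarith only [k1, hX1]
          have i2 : T₁ + T₁ * (2 + T₁ * (LB + Lb) + κ * ℓ) + (1 - Real.log 2 * S₀ +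
              (T₀ + T₁ + M + T₀ * (c3 + t₁ * ℓ) + T₁ * (T₁ * La + 2 * ρ))) ≤ -1 := by
            linarith only [k2, hX2]
          exact add_le_add (Real.exp_le_exp.2 i1) (Real.exp_le_exp.2 i2)
  have he : Real.exp (-1) < 1 / 2 := by
    rw [Real.exp_neg, ← one_div]
    have h2e : (2 : ℝ) < Real.exp 1 := by
      have := Real.add_one_lt_exp (by norm_num : (1 : ℝ) ≠ 0); norm_num at this; exact this
    exact one_div_lt_one_div_of_lt (by norm_num) h2e
  exact hlt.trans_lt (by linarith only [he])

/-- The heart of Proposition 3 (`prop3_taylor` + `prop3_smallness` + `prop3_numeric`): for large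
`M`, if some `δ ≥ M^{-κ}` separates the powers `β^j` (`1 ≤ j ≤ M^{t₁}`) of `β = α e^{-y}` from
`1`, then no non-zero `Q ∈ ℤ[X₀, X₁]` with `deg_{X₀} Q ≤ M^{t₀}`, `deg_{X₁} Q ≤ M^{t₁}`,
`H(Q) ≤ e^M` has `|(D^k Q)(m y, α^m)| ≤ e^{-M^u}` for all `k ≤ M^{s₀}`, `m ≤ M^{s₁}`.
[cite: Roy2001, Prop. 3] -/
theorem prop3_core {y α : ℂ} (hα : α ≠ 0) {s₀ s₁ t₀ t₁ u : ℝ} (hs₀ : 0 < s₀) (ht₁ : 0 < t₁)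
    (hu : 0 < u) (h1 : max 1 (max t₀ (2 * t₁)) < min s₀ (2 * s₁)) (h2 : min s₀ (2 * s₁) < u)
    {κ : ℝ} (hκ : 0 < κ) :
    ∀ᶠ M : ℕ in atTop, ∀ δ : ℝ, 1 ≤ δ * (M : ℝ) ^ κ →
      (∀ j : ℕ, 1 ≤ j → (j : ℝ) ≤ (M : ℝ) ^ t₁ → δ ≤ ‖(α * cexp (-y)) ^ j - 1‖) →
      ∀ Q : MvPolynomial (Fin 2) ℤ, Q ≠ 0 → (Q.degreeOf 0 : ℝ) ≤ (M : ℝ) ^ t₀ →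
        (Q.degreeOf 1 : ℝ) ≤ (M : ℝ) ^ t₁ → (mvPolyHeight Q : ℝ) ≤ Real.exp M →
        ¬ ∀ k m : ℕ, (k : ℝ) ≤ (M : ℝ) ^ s₀ → (m : ℝ) ≤ (M : ℝ) ^ s₁ →
            ‖aeval ![(m : ℂ) * y, α ^ m] (royD^[k] Q)‖ ≤ Real.exp (-(M : ℝ) ^ u) := by
  -- consequences of the parameter inequalities
  have hmax := max_lt_iff.1 h1
  have hmax' := max_lt_iff.1 hmax.2
  have h1s₀ : 1 < s₀ := lt_of_lt_of_le hmax.1 (min_le_left _ _)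
  have ht₀s₀ : t₀ < s₀ := lt_of_lt_of_le hmax'.1 (min_le_left _ _)
  have h2t₁s₀ : 2 * t₁ < s₀ := lt_of_lt_of_le hmax'.2 (min_le_left _ _)
  have ht₁s₀ : t₁ < s₀ := by linarith
  have ht₁s₁ : t₁ ≤ s₁ := by
    have := lt_of_lt_of_le hmax'.2 (min_le_right _ _); linarith
  have h2t₁u : 2 * t₁ < u := hmax'.2.trans h2
  have ht₁u : t₁ < u := by linarith
  -- the constants attached to `y`, `α`, `β = α e^{-y}`
  have hβ0 : α * cexp (-y) ≠ 0 := mul_ne_zero hα (Complex.exp_ne_zero _)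
  have hB1 : 1 ≤ max 1 ‖α * cexp (-y)‖ := le_max_left _ _
  have hb0 : 0 < min 1 ‖α * cexp (-y)‖ := lt_min one_pos (norm_pos_iff.2 hβ0)
  have hb1 : min 1 ‖α * cexp (-y)‖ ≤ 1 := min_le_left _ _
  have hA1 : 1 ≤ max 1 ‖α‖ := le_max_left _ _
  have hcy0 : 0 ≤ ‖y‖ := norm_nonneg _
  -- numerics
  have H := eventually_prop3_numerics hu hs₀ ht₁.le ht₁u h2t₁u ht₁s₀ h2t₁s₀ ht₀s₀ h1s₀
    (c₁ := 3 + ‖y‖)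
    (c₂ := Real.log (max 1 ‖α * cexp (-y)‖) + Real.log (min 1 ‖α * cexp (-y)‖)⁻¹) (c₃ := κ)
    (c₄ := Real.log (max 1 ‖α * cexp (-y)‖) + Real.log (min 1 ‖α * cexp (-y)‖)⁻¹ +
      Real.log (max 1 ‖α‖) + 2 * ‖y‖)
    (c₅ := 1 + Real.log (3 * (1 + ‖y‖))) hκ.le
  filter_upwards [tendsto_natCast_atTop_atTop.eventually H] with M hM
  obtain ⟨hM1, hX1, hX2⟩ := hM
  intro δ hδ hsep Q hQ hd0 hd1 hH hsmall
  have hM0 : (0 : ℝ) < M := one_pos.trans_le hM1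
  have hT₁1 : 1 ≤ (M : ℝ) ^ t₁ := Real.one_le_rpow hM1 ht₁.le
  have hS₀0 : 0 ≤ (M : ℝ) ^ s₀ := Real.rpow_nonneg hM0.le _
  -- `δ > 0` and `1/δ ≤ M^κ = exp(κ log M)`
  have hMκ : 0 < (M : ℝ) ^ κ := Real.rpow_pos_of_pos hM0 κ
  have hδ0 : 0 < δ := by
    by_contra h
    have : δ * (M : ℝ) ^ κ ≤ 0 := mul_nonpos_of_nonpos_of_nonneg (not_lt.1 h) hMκ.le
    linarith
  have hδinv : δ⁻¹ ≤ Real.exp (κ * Real.log M) := by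
    rw [inv_le_iff_one_le_mul₀ hδ0, mul_comm κ, ← Real.rpow_def_of_pos hM0, mul_comm]
    exact hδ
  -- Step 1
  have hρ : 1 + (Q.degreeOf 1 : ℝ) * ‖y‖ ≤ 1 + (M : ℝ) ^ t₁ * ‖y‖ := by gcongr
  have hstep1 : ∀ n : ℕ, n ≤ Q.degreeOf 1 → ∀ t : ℂ, ‖t‖ ≤ 1 + (M : ℝ) ^ t₁ * ‖y‖ →
      ‖aeval ![(n : ℂ) * y + t, α ^ n * cexp t] Q‖ ≤
        Real.exp (-(M : ℝ) ^ u) * Real.exp (1 + (M : ℝ) ^ t₁ * ‖y‖) +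
          2 * (1 / 2) ^ (⌊(M : ℝ) ^ s₀⌋₊ + 1) *
            ((((Q.degreeOf 0 + 1) * (Q.degreeOf 1 + 1) : ℕ) : ℝ) * mvPolyHeight Q *
              (3 * (1 + (M : ℝ) ^ t₁ * ‖y‖)) ^ Q.degreeOf 0 *
              ((max 1 ‖α‖) ^ Q.degreeOf 1 * Real.exp (2 * (1 + (M : ℝ) ^ t₁ * ‖y‖))) ^
                Q.degreeOf 1) := by
    intro n hn t ht
    refine prop3_taylor Q le_rfl le_rfl hn hρ (Real.exp_pos _).le (le_max_right _ _) hA1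
      (fun k hk => hsmall k n ?_ ?_) ht
    · exact (Nat.cast_le.2 (Nat.lt_succ_iff.1 hk)).trans (Nat.floor_le hS₀0)
    · exact ((Nat.cast_le.2 hn).trans hd1).trans (Real.rpow_le_rpow_of_exponent_le hM1 ht₁s₁)
  -- Steps 2–3
  have hsepD : ∀ j : ℕ, 1 ≤ j → j ≤ Q.degreeOf 1 → δ ≤ ‖(α * cexp (-y)) ^ j - 1‖ :=
    fun j hj hjD => hsep j hj ((Nat.cast_le.2 hjD).trans hd1)
  have hA := prop3_smallness hQ le_rfl hρ hδ0 (le_max_right _ _) hB1 le_rfl hb0 hsepD hstep1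
  -- Step 4
  have hL : (M : ℝ) ^ s₀ ≤ ((⌊(M : ℝ) ^ s₀⌋₊ + 1 : ℕ) : ℝ) := by
    push_cast; exact (Nat.lt_floor_add_one _).le
  have hN := prop3_numeric (Real.rpow_nonneg hM0.le t₀) hT₁1 (Real.log_nonneg hM1) hcy0 hκ.le
    hd0 hd1 hL (Real.log_rpow hM0 t₁) (Nat.cast_nonneg _) hH hδ0 hδinv hB1 hb0 hb1 hA1 hX1 hX2
  exact absurd hA (not_le.2 hN)

/-- **Roy 2001, Proposition 3** (discharged): if `α e^{-y}` is not a root of unity and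
`max{1, t₀, 2t₁} < min{s₀, 2s₁} < u`, condition (b) of Theorem 1 fails. The printed proof uses
the two-variable interpolation Theorem 2; here `prop3_core` (Taylor expansion along `w = (1,1)`
plus one-variable Lagrange interpolation in `e^w`) replaces it, the Diophantine input being, as in
print, Lemma 4 (case `|α e^{-y}| = 1`; the case `|α e^{-y}| ≠ 1` needs none).
[cite: Roy2001, Prop. 3] -/
theorem Roy2001_prop3_holds : Roy2001_prop3 := by
  intro y α hα s₀ s₁ t₀ t₁ u hs₀ hs₁ ht₀ ht₁ hu h1 h2 hna hb
  have hβ0 : α * cexp (-y) ≠ 0 := mul_ne_zero hα (Complex.exp_ne_zero _)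
  have hrou : ∀ d : ℕ, 1 ≤ d → (α * cexp (-y)) ^ d ≠ 1 := fun d hd h =>
    hna ((royCondA_iff y α).2 ⟨d, hd, h⟩)
  have hb' : ∀ᶠ M : ℕ in atTop, ∃ Q : MvPolynomial (Fin 2) ℤ, Q ≠ 0 ∧
      (Q.degreeOf 0 : ℝ) ≤ (M : ℝ) ^ t₀ ∧ (Q.degreeOf 1 : ℝ) ≤ (M : ℝ) ^ t₁ ∧
      (mvPolyHeight Q : ℝ) ≤ Real.exp M ∧
      ∀ k m : ℕ, (k : ℝ) ≤ (M : ℝ) ^ s₀ → (m : ℝ) ≤ (M : ℝ) ^ s₁ →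
        ‖aeval ![(m : ℂ) * y, α ^ m] (royD^[k] Q)‖ ≤ Real.exp (-(M : ℝ) ^ u) := hb
  rcases eq_or_ne ‖α * cexp (-y)‖ 1 with hβ1 | hβ1
  · /- Case `|β| = 1`: `β = e^{2πia}` with `a` real irrational; Lemma 4 at a level `N` and
      `M = ⌈N^{1/(t₁+1)}⌉`, so that `M^{t₁} ≪ N ≤ M^{t₁+1}`. -/
    have hκ0 : 0 < t₁ + 1 := by linarith
    have hcore := prop3_core (y := y) hα hs₀ ht₁ hu h1 h2 hκ0
    obtain ⟨M₀, hM₀⟩ := eventually_atTop.1 (hcore.and hb')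
    have hairr := forall_ratCast_ne_arg_div hβ1 hrou
    have L4 := Roy2001_lemma4 hairr
    have hN : ∀ᶠ N : ℕ in atTop, (M₀ : ℝ) ≤ (N : ℝ) ^ (1 / (t₁ + 1)) ∧
        (1 + |arg (α * cexp (-y)) / (2 * Real.pi)|) * 2 ^ t₁ * (N : ℝ) ^ (t₁ / (t₁ + 1)) + 1 ≤ N ∧
        (1 : ℝ) ≤ N := by
      have H : ∀ᶠ x : ℝ in atTop, (M₀ : ℝ) ≤ x ^ (1 / (t₁ + 1)) ∧
          (1 + |arg (α * cexp (-y)) / (2 * Real.pi)|) * 2 ^ t₁ * x ^ (t₁ / (t₁ + 1)) + 1 ≤ x ∧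
          1 ≤ x := by
        have hk1 : 0 < 1 / (t₁ + 1) := by positivity
        have hk2 : t₁ / (t₁ + 1) < 1 := by rw [div_lt_one hκ0]; linarith
        filter_upwards [eventually_const_le_mul_rpow (M₀ : ℝ) hk1 one_pos,
          eventually_mul_rpow_le_mul_rpow ((1 + |arg (α * cexp (-y)) / (2 * Real.pi)|) * 2 ^ t₁)
            hk2 (by norm_num : (0 : ℝ) < 1 / 2), eventually_ge_atTop (2 : ℝ)] with x e1 e2 e3
        refine ⟨by simpa using e1, ?_, by linarith⟩
        rw [Real.rpow_one] at e2; linarith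
      exact tendsto_natCast_atTop_atTop.eventually H
    obtain ⟨N, hsepN, hN1, hN2, hN3⟩ := (L4.and_eventually hN).exists
    have hN0 : (0 : ℝ) ≤ (N : ℝ) := Nat.cast_nonneg _
    have hNpos : (0 : ℝ) < N := by linarith
    have hMge : (N : ℝ) ^ (1 / (t₁ + 1)) ≤ (⌈(N : ℝ) ^ (1 / (t₁ + 1))⌉₊ : ℕ) := Nat.le_ceil _
    have hMlt : ((⌈(N : ℝ) ^ (1 / (t₁ + 1))⌉₊ : ℕ) : ℝ) < (N : ℝ) ^ (1 / (t₁ + 1)) + 1 :=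
      Nat.ceil_lt_add_one (Real.rpow_nonneg hN0 _)
    have hM₀M : M₀ ≤ ⌈(N : ℝ) ^ (1 / (t₁ + 1))⌉₊ := by exact_mod_cast hN1.trans hMge
    obtain ⟨hc, Q, hQ, hd0, hd1, hH, hsmall⟩ := hM₀ _ hM₀M
    refine hc (1 / N) ?_ ?_ Q hQ hd0 hd1 hH hsmall
    · have hMκ : (N : ℝ) ≤ ((⌈(N : ℝ) ^ (1 / (t₁ + 1))⌉₊ : ℕ) : ℝ) ^ (t₁ + 1) := by
        calc (N : ℝ) = ((N : ℝ) ^ (1 / (t₁ + 1))) ^ (t₁ + 1) := by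
              rw [← Real.rpow_mul hN0, one_div_mul_cancel hκ0.ne', Real.rpow_one]
          _ ≤ _ := Real.rpow_le_rpow (Real.rpow_nonneg hN0 _) hMge hκ0.le
      rw [one_div, inv_mul_eq_div, le_div_iff₀ hNpos, one_mul]
      exact hMκ
    · intro j hj1 hjT
      set X : ℝ := 2 ^ t₁ * (N : ℝ) ^ (t₁ / (t₁ + 1)) with hX
      have hX0 : 0 ≤ X := by positivity
      have hMt : ((⌈(N : ℝ) ^ (1 / (t₁ + 1))⌉₊ : ℕ) : ℝ) ^ t₁ ≤ X := by
        have h1N : 1 ≤ (N : ℝ) ^ (1 / (t₁ + 1)) := Real.one_le_rpow hN3 (by positivity)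
        calc ((⌈(N : ℝ) ^ (1 / (t₁ + 1))⌉₊ : ℕ) : ℝ) ^ t₁ ≤ ((N : ℝ) ^ (1 / (t₁ + 1)) + 1) ^ t₁ :=
              Real.rpow_le_rpow (Nat.cast_nonneg _) hMlt.le ht₁.le
          _ ≤ (2 * (N : ℝ) ^ (1 / (t₁ + 1))) ^ t₁ :=
              Real.rpow_le_rpow (by positivity) (by linarith) ht₁.le
          _ = X := by
              rw [hX, Real.mul_rpow (by norm_num) (by positivity), ← Real.rpow_mul hN0]
              congr 2; field_simp
      have hj' : (j : ℝ) ≤ X := hjT.trans hMt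
      set A : ℝ := |arg (α * cexp (-y)) / (2 * Real.pi)| with hA
      have hA0 : 0 ≤ A := abs_nonneg _
      have hAX : 0 ≤ A * X := mul_nonneg hA0 hX0
      have e : (1 + A) * X = X + A * X := by ring
      have hjA : (j : ℝ) * A ≤ A * X := by rw [mul_comm A X]; exact mul_le_mul_of_nonneg_right hj' hA0
      have hjN : j < N := by
        have : (j : ℝ) < N := by linarith
        exact_mod_cast this
      have hja : j * A + 1 ≤ N := by linarith
      have := two_div_le_norm_pow_sub_one hβ1 hsepN hj1 hjN hja
      calc (1 : ℝ) / N ≤ 2 / N := by gcongr; norm_num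
        _ ≤ _ := this
  · /- Case `|β| ≠ 1`: the powers of `β` stay `≥ | |β| - 1 |` away from `1`. -/
    have hδ0 : 0 < |‖α * cexp (-y)‖ - 1| := abs_pos.2 (sub_ne_zero.2 hβ1)
    have hcore := prop3_core (y := y) hα hs₀ ht₁ hu h1 h2 (one_pos : (0 : ℝ) < 1)
    have hδev : ∀ᶠ M : ℕ in atTop, 1 ≤ |‖α * cexp (-y)‖ - 1| * (M : ℝ) ^ (1 : ℝ) :=
      tendsto_natCast_atTop_atTop.eventually (eventually_const_le_mul_rpow 1 one_pos hδ0)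
    obtain ⟨M, hc, ⟨Q, hQ, hd0, hd1, hH, hsmall⟩, hδM⟩ := (hcore.and (hb'.and hδev)).exists
    exact hc _ hδM (fun j hj _ => abs_norm_sub_one_le_norm_pow_sub_one _ hj) Q hQ hd0 hd1 hH hsmall

/-- **Roy 2001, Theorem 1, `(b) ⇒ (a)`** (discharged): for `α ≠ 0` and parameters in the
window (1), condition (b) forces `α^d = e^{dy}` for some `d ≥ 1`. [cite: Roy2001, Thm. 1] -/
theorem royThm1BtoA_holds : RoyThm1BtoA :=
  royThm1BtoA_of_prop3 Roy2001_prop3_holds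

/-- **Roy 2001, §5 — Conjecture 2 for rank `l` is equivalent to Schanuel's conjecture for
rank `l`** (discharge of the named fact `Roy2001_iff`): `2°` (`RoyCriterion l → SchanuelRank l`)
is `schanuelRank_of_royCriterion'` (auxiliary polynomial `exists_royAuxPoly` + Cauchy), `1°`
(`SchanuelRank l → RoyCriterion l`) is `royCriterion_of_schanuelRank` fed with Theorem 1
`(b) ⇒ (a)`, i.e. with Proposition 3 (`Roy2001_prop3_holds`). [cite: Roy2001, §5 (pp. 193–194)] -/
theorem Roy2001_iff_holds : Roy2001_iff :=
  Roy2001_iff_of_prop3 Roy2001_prop3_holds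

end Literature.NumberTheory.Transcendental

end

namespace Literature.NumberTheory.Transcendental

/-- **`RoyThm1BtoA` is a theorem of the tree (audit alias).** The named fact `RoyThm1BtoA`
(`RoyCriterionProofs.lean`): The implication `(b) ⇒ (a)` of Theorem 1 for admissible
parameters — the only part of Theorem 1 used in §5, 1°. — is proved, with exactly this
statement, by `royThm1BtoA_holds` (this file); this alias records the discharge under the
census/audit name `RoyThm1BtoA_holds` (librarian sweep g25, pass 5c; no new mathematics).
[cite: Roy2001, Thm. 1] -/
theorem RoyThm1BtoA_holds :
    RoyThm1BtoA :=
  Literature.NumberTheory.Transcendental.royThm1BtoA_holds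

end Literature.NumberTheory.Transcendental
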